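import Literature.NumberTheory.Automorphic.Liu2021.AppendixC.DefC1toC3   -- ★ `HermSpace F₀ F` (`n`, `form`, `basis`, `gram`, `unitaryGroup`), ★ `conj`; brings ★ `UnitaryScheme.points`
import Mathlib.LinearAlgebra.Matrix.SchurComplement                        -- `Matrix.fromBlocksZero₂₁Invertible` (block-diagonal units)
import HarnessLib

/-!
# [RapoportSmithlingZhang2020Diagonal] §2 «Group-theoretic setup» (§2.1 «Similitude groups and variants», §2.2 «Orbit matching»)
# — STATED AS PRINTED (named-fact carpet; NO proofs, NO `sorry`, NO instance, NO notation)

M. Rapoport, B. Smithling, W. Zhang, *Arithmetic diagonal cycles on unitary Shimura varieties*, Compos. Math. **156** (2020)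
1745–1824 = arXiv:1710.06962 **v6** (bib key `RapoportSmithlingZhang2020Diagonal`).  PAGE PINS «p. N» = arXiv v6 PDF page, read on the
cell's per-page text of record `F0/P6/lit1/RSZ2020-v6-pages.txt` (item map `RSZ2020-v6-itemmap.lit1-g5.md` 15cc0883: «§2 Group-theoretic
setup p. 7 (2.1 Similitude groups p. 7; Lemma 2.1 p. 8)»); the Compositio offset is not held and no journal page is claimed.  §2 occupies
pp. 7–8: §2.1 = the groups `G′`, `H′₁`, `H′₂`, `H′₁,₂`, `W`, `u`, `W♭`, `G`, `H`, `G_W`, `H_W`, `Z^ℚ`, `H^ℚ`, `G^ℚ`, `H̃`, `G̃`, `H̃G` (p. 7), the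
product decompositions **(2.1)** and the closed embeddings **(2.2)** (p. 8); §2.2 = **Lemma 2.1** (p. 8, the ONLY numbered item of §2), the
orbit-matching injection and **(2.3)** (p. 8).

Cell `hodgecm-mathlib`, GO-500 carpet squad TKR (seat TKR-t04), file 1 of the t04 deal (TKR-plan SPLIT-TKR.v1 7831d55e3c6c3b32 §D:
«RSZ2020 §2 → `Sec2GroupTheoreticSetup.lean` (v6 pp. 7–8: Z^ℚ, G, G̃, H, H̃, similitude character c, (2.1)–(2.x), Lemma 2.1)»).
HONEST LABEL: HC_CM is proved only modulo the 7 printed citations (2 remaining: hLiu418 = stmt-HodgeConjecture-24832, h413 =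
stmt-HodgeConjecture-24833) until rung 0 closes; this file asserts NOTHING — every claim of §2 is a `def … : Prop` that a consumer takes as a
hypothesis `(h : Item D)` for ITS OWN datum `D`, and nothing printed is claimed to hold.

## Scope note (generality).  §2 opens «Let `F/F₀` be a quadratic extension of number fields» (p. 7); from §3 on (p. 8) «we take `F` to be a
CM field over `ℚ` and `F₀` to be its totally real subfield of index 2».  The tree's hermitian-space carrier ★ `Liu2021.AppendixC.HermSpace F₀ F`
(with its involution ★ `conj F₀ F`) is stated for the CM case, so THIS FILE TYPES §2 IN THE CM CASE — the only case used in §§3–8.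
-- TODO(general form): §2 for an arbitrary quadratic extension `F/F₀` of number fields needs a hermitian-space carrier over a general
-- quadratic étale algebra (the nontrivial automorphism of `F/F₀` in place of ★ `conj`); nothing below uses CM beyond the carrier's signature.

## How the printed objects are typed (paper order).  REAL = genuine Mathlib ∕ tree object; READINGS R1–R5.

* ALGEBRAIC GROUPS are typed through their FUNCTORS OF POINTS on commutative algebras (READING R1, the discipline of ★
  `Liu2021.AppendixC.HermSpace.unitaryGroup` ∕ ★ `UnitaryScheme.points`: «`U(V)(R) = {g ∈ GL_R(V ⊗_F R) ∣ …}`»): a group over `F₀` is the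
  assignment `A ↦ 𝒢(A)` on commutative `F₀`-algebras `A`, a group over `ℚ` the assignment `R ↦ 𝒢(R)` on commutative `ℚ`-algebras `R`;
  Weil restriction `Res_{F₀/ℚ} 𝒢` is `R ↦ 𝒢(F₀ ⊗_ℚ R)` (★ `HermSpace.resPoints`), and `Res_{F/F₀} GL_m` is `A ↦ GL_m(F ⊗_{F₀} A)`.
  Representability, smoothness, reductivity and «closed» (for embeddings) are attributes of the group SCHEMES and are NOT typed.
* «`W` a non-degenerate `F/F₀`-hermitian space of dimension `n ≥ 2`», «a non-isotropic vector `u ∈ W`, which we call the special vector»,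
  «`W♭` the orthogonal complement of `u` in `W`» (p. 7) = the REAL structure `Sec2Datum`: `W : HermSpace F₀ F` (★; form `F`-linear in the
  first variable, Notation p. 6), `2 ≤ W.n`, `u : W.V` with `(u,u) ≠ 0`, and `W♭` REALISED as a hermitian space `Wflat : HermSpace F₀ F` of
  dimension `n − 1` together with an `F`-linear isometric embedding `incl : W♭ → W` whose image is `u^⊥` (READING R2: the orthogonal
  complement, a hermitian space in its own right since `u` is non-isotropic, is carried as a datum pinned down up to unique isometry by
  `incl_form` ∕ `range_incl`; nothing is asserted).
* COORDINATES (READING R3).  `W = W♭ ⊕ F u` (p. 8: «the decomposition `W = W♭ ⊕ Fu`»), so `W` has the ADAPTED basis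
  `(incl e₁, …, incl e_{n−1}, u)` (`e` = ★ `HermSpace.basis` of `W♭`), indexed by `Fin (n−1) ⊕ Unit`; in it the Gram matrix of `W` is the block
  matrix `J_W = diag(J_{W♭}, (u,u))` (`gramW`), and `U(W)(A)`, `GU(W)(A)` are the matrix groups of `J_W` (★ `UnitaryScheme.points`).  This is the
  coordinate system in which the printed embeddings (2.2) «`(z, h) ↦ (z, diag(h, z))`» are LITERAL block matrices.  (★ `W.unitaryGroup A` is the
  same group in the coordinates of ★ `W.basis`; the two differ by the change-of-basis matrix and are not identified here.)
* SIMILITUDE FACTORS (READING R4).  «We systematically use the symbol `c` to denote the similitude factor of a point on a unitary similitude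
  group» (p. 7).  A point of `G^ℚ`, `H^ℚ`, `Z^ℚ`, `G̃`, `H̃`, `H̃G` over `R` is typed TOGETHER WITH its multiplier `c ∈ 𝔾_m(R) = Rˣ`
  (resp. `Nm_{F/F₀}(z) ∈ Rˣ`): e.g. `G^ℚ(R) = {(g, c) ∈ GL(W)(F ⊗_ℚ R) × Rˣ ∣ ḡᵀ J_W g = c·J_W}` — the GRAPH of `c` on the printed group (the
  projection to `g` is injective because `J_W` is invertible and `R → F ⊗_ℚ R` is injective, `F` being free over `ℚ`); the group law is the
  componentwise one of the ambient product of unit groups, which is the printed group law.  `F ⊗_ℚ R` is realised as `F ⊗_{F₀} (F₀ ⊗_ℚ R)` (★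
  `HermSpace.resPoints`), with involution `c ⊗ 1` (★ `UnitaryScheme.baseConj`) and `Nm_{F/F₀}(z) = z·z̄`.
* QUOTIENTS IN LEMMA 2.1 (READING R5).  «`G̃/H̃ ⥲ Res G/Res H`» and «`H̃\H̃G/H̃ ⥲ Res H\Res G_W/Res H`» are isomorphisms of quotients of
  algebraic groups; they are typed ON `R`-POINTS as: the printed map is surjective `G̃(R) → G(F₀ ⊗_ℚ R)` and identifies (double) cosets of
  `R`-points — which is what (2.1) gives verbatim («The following lemma is obvious», p. 8), and is the form in which (2.3) uses the lemma on
  `ℚ_p`-points.  The sheaf-theoretic quotient statement is RECORDED, not typed.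
* NOT TYPED (RECORDED; no carrier posited): §2.2's «natural injection of orbit spaces of regular semisimple elements
  `H(F₀,v)\G_W(F₀,v)_rs/H(F₀,v) ↪ H′₁(F₀,v)\G′(F₀,v)_rs/H′₂(F₀,v)` for any place `v` of `F₀` (cf. [42, §2] … the case of archimedean places is
  completely analogous). If `v` is split in `F`, we define matching as in [57, §2]. Briefly speaking, we identify `H(F₀,v)` with `GL_{n−1}(F₀,v)` and
  `G(F₀,v)` with `GL_n(F₀,v)`. This gives a natural way of matching regular semisimple elements, a homogeneous version of the matching relation of
  [55]» and **(2.3)** «`H̃(ℚ_p)\H̃G(ℚ_p)_rs/H̃(ℚ_p) ↪ ∏_{v∣p} H′₁(F₀,v)\G′(F₀,v)_rs/H′₂(F₀,v)`» (p. 8): the notion «regular semisimple» and the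
  matching relation are DEFINED BY CITATION ([42] = RapoportTerstiegeZhang2013, [57] = Zhang2012, [55] = Zhang2014 in RSZ's bibliography
  pp. 61–63), not printed in §2; a consumer needing (2.3) posits the injection on its own datum and cites p. 8.  The double-coset RELATIONS
  themselves (by `H × H` on `G_W`, by `H̃ × H̃` on `H̃G`) ARE typed (`Lemma21_doubleCoset`).

**ED. 2** (squad ruling R-9a: a tree-provable closed row is a theorem): ALL SEVEN closed rows of ED. 1 are PROVED at the end of the file — the file is
debt-free.  `Sec2Datum.ZQ_central_holds` («`Z^ℚ` is naturally a central subgroup of `H^ℚ` and `G^ℚ`», p. 8: `z ↦ z·1` is injective on a non-empty index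
type, scalar matrices are central, and `(z̄·1)ᵀ (J ⊗ 1) (z·1) = Nm_{F/F₀}(z)·(J ⊗ 1)` for ANY Gram matrix `J`); `Sec2Datum.Eq21_productDecomposition_holds` ((2.1)
on `R`-points: `z⁻¹g` is `J_W`-unitary over `F₀ ⊗_ℚ R` because `z̄⁻¹z⁻¹·c(g) = 1` when `Nm z = c(g)`; injective by cancelling `z⁻¹`; `(z, g₀) ↦ (z, z g₀)` is a
section); `Sec2Datum.Eq22_embeddings_holds` ((2.2): `diag(h, z)` is a similitude of `diag(J_{W♭}, (u,u))` with the multiplier of `h` when `Nm z = c(h)`, block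
by block; injectivity slot by slot); `Sec2Datum.Eq22_compatible_holds` (the sentence after (2.2): `z⁻¹·diag(h, z) = diag(z⁻¹h, 1)`);
`Sec2Datum.Lemma21_coset_holds`, `Sec2Datum.Lemma21_doubleCoset_holds`, `Sec2Datum.Lemma21_holds` (Lemma 2.1 on `R`-points, «obvious» in print: sections
`g₀ ↦ (1, g₀, 1)`, `(h₀, g₀) ↦ (1, h₀, g₀, 1)`; coset matching by `h' := w⁻¹k` one way and `h := (z⁻¹z', (z⁻¹z')·h', c⁻¹c')` the other, `Z^ℚ(R)` being a group
(`mul_mem_ZQ`, `inv_mem_ZQ`, `one_mem_ZQ`) and scalars central).  Helpers (our lemmas, all proved): the matrix API of `scalarGL` ∕ `blockDiagGL`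
(`scalarGL_val`, `scalarGL_inv_val`, `scalarGL_inv`, `scalarGL_mul`, `scalarGL_one`, `blockDiagGL_val`, `scalarGL_mul_val`, `scalarGL_inv_mul_val`, `scalarGL_injective`,
`scalarGL_comm`, `scalarGL_inv_comm`, `scalarGL_inv_mul_blockDiagGL`, `scalarGL_mul_blockDiagGL`, `scalarGL_coset_identity`, `scalarGL_triple_identity`,
`scalarGL_triple_identity'`, `blockDiagGL_left_inj`) and the form computations `isSimil_scalarGL_of_mem_ZQ`, `baseForm_fromBlocks`, `isSimil_blockDiagGL`,
`conjForm_smul` (entrywise), `mem_points_of_isSimil`, `isSimil_of_mem_points` over ★ `UnitaryScheme.mem_points_iff`.  Every other line is byte-identical to ED. 1.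

## References
* [RapoportSmithlingZhang2020Diagonal] M. Rapoport, B. Smithling, W. Zhang, *Arithmetic diagonal cycles on unitary Shimura varieties*, Compos.
  Math. 156 (2020) 1745–1824, arXiv:1710.06962v6 — Notation pp. 5–7; §2.1 p. 7–8 ((2.1), (2.2)); §2.2 p. 8 (Lemma 2.1, (2.3)).
* [Liu2021] Y. Liu, *Fourier–Jacobi cycles and arithmetic relative trace formula*, Camb. J. Math. 9 (2021) — App. C (the tree's `HermSpace`
  carrier and its functor of points, l. 4558–4579).
* [Mok2014] C. P. Mok, *Endoscopic classification of representations of quasi-split unitary groups*, Mem. AMS 1108 — §1 p. 5 (the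
  functor-of-points convention `U(J)(A) = {g ∈ GL_n(E ⊗_F A) ∣ ᵗḡ J g = J}` of ★ `UnitaryScheme.points`).
-/

noncomputable section

open scoped TensorProduct Matrix MatrixGroups
open NumberField
open Literature.NumberTheory.Automorphic (UnitaryScheme.points UnitaryScheme.baseConj UnitaryScheme.baseForm)
open Literature.NumberTheory.Automorphic.Liu2021.AppendixC (HermSpace conj)

namespace Literature.AlgebraicGeometry.ShimuraVarieties.RapoportSmithlingZhang2020.Sec2GroupTheoreticSetup

variable (F₀ F : Type) [Field F₀] [NumberField F₀] [IsTotallyReal F₀] [Field F] [NumberField F] [Algebra F₀ F]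
  [IsTotallyComplex F] [Algebra.IsQuadraticExtension F₀ F]

/-! ## §2.1, first paragraph (p. 7): the general linear groups `G′`, `H′₁`, `H′₂`, `H′₁,₂` over `F₀` (functor of points, READING R1) -/

/-- **`G′ := Res_{F/F₀}(GL_{n−1} × GL_n)`** (p. 7), on `A`-points for a commutative `F₀`-algebra `A`, with `n = m + 1` (`n ≥ 2` throughout §2,
p. 7): `G′(A) = GL_{n−1}(F ⊗_{F₀} A) × GL_n(F ⊗_{F₀} A)`.  REAL (Mathlib `GL`). [cite: RapoportSmithlingZhang2020Diagonal, §2.1 p. 7] -/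
abbrev G'pts (m : ℕ) (A : Type) [CommRing A] [Algebra F₀ A] : Type :=
  GL (Fin m) (F ⊗[F₀] A) × GL (Fin (m + 1)) (F ⊗[F₀] A)

/-- **`H′₁ := Res_{F/F₀} GL_{n−1}`** (p. 7), on `A`-points (`n = m + 1`): `H′₁(A) = GL_{n−1}(F ⊗_{F₀} A)`.  REAL.
[cite: RapoportSmithlingZhang2020Diagonal, §2.1 p. 7] -/
abbrev H'₁pts (m : ℕ) (A : Type) [CommRing A] [Algebra F₀ A] : Type :=
  GL (Fin m) (F ⊗[F₀] A)

/-- **`H′₂ := GL_{n−1} × GL_n`** (over `F₀`, p. 7), on `A`-points (`n = m + 1`): `H′₂(A) = GL_{n−1}(A) × GL_n(A)`; and **`H′₁,₂ := H′₁ × H′₂`**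
(p. 7) is the product `H'₁pts F₀ F m A × H'₂pts m A` (not given a separate name).  REAL. [cite: RapoportSmithlingZhang2020Diagonal, §2.1 p. 7] -/
abbrev H'₂pts (m : ℕ) (A : Type) [CommRing A] : Type :=
  GL (Fin m) A × GL (Fin (m + 1)) A

/-! ## The involution `a ↦ ā` and the block matrices used below (Notation p. 5; READING R3) -/

/-- `c`, the nontrivial automorphism of `F/F₀` (Notation p. 5 «`a ↦ ā`»), as an `F₀`-algebra endomorphism of `F` (★ `conj F₀ F`), the
involution fed to ★ `UnitaryScheme.points`. [cite: RapoportSmithlingZhang2020Diagonal, §1 Notation p. 5] -/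
abbrev cbar : F →ₐ[F₀] F := ((conj F₀ F : F ≃ₐ[F₀] F) : F →ₐ[F₀] F)


/-- The invertible block-diagonal matrix `diag(h, z) ∈ GL_{κ ⊕ Unit}(S)` for `h ∈ GL_κ(S)`, `z ∈ Sˣ` (Mathlib `Matrix.fromBlocks`, invertible by
`Matrix.fromBlocksZero₂₁Invertible`) — the shape of the printed embeddings (2.2) «`diag(h, z)`» and of `H ↪ G`, `h ↦ diag(h, 1)`. REAL.
[cite: RapoportSmithlingZhang2020Diagonal, §2.1 (2.2) p. 8] -/
def blockDiagGL {S : Type} [CommRing S] {κ : Type} [Fintype κ] [DecidableEq κ] (h : GL κ S) (z : Sˣ) : GL (κ ⊕ Unit) S :=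
  letI : Invertible (h : Matrix κ κ S) := h.invertible
  letI : Invertible ((Units.map ((Matrix.scalar Unit : S →+* Matrix Unit Unit S) : S →* Matrix Unit Unit S) z : GL Unit S) :
      Matrix Unit Unit S) :=
    (Units.map ((Matrix.scalar Unit : S →+* Matrix Unit Unit S) : S →* Matrix Unit Unit S) z).invertible
  letI : Invertible (Matrix.fromBlocks (h : Matrix κ κ S) 0 0
      ((Units.map ((Matrix.scalar Unit : S →+* Matrix Unit Unit S) : S →* Matrix Unit Unit S) z : GL Unit S) : Matrix Unit Unit S)) :=
    Matrix.fromBlocksZero₂₁Invertible _ _ _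
  unitOfInvertible (Matrix.fromBlocks (h : Matrix κ κ S) 0 0
      ((Units.map ((Matrix.scalar Unit : S →+* Matrix Unit Unit S) : S →* Matrix Unit Unit S) z : GL Unit S) : Matrix Unit Unit S))

/-- The invertible scalar matrix `z·1 ∈ GL_κ(S)` for `z ∈ Sˣ` (Mathlib `Matrix.scalar`), through which `Z^ℚ` sits in `H^ℚ` and `G^ℚ` (p. 8) and
by whose inverse the decompositions (2.1) divide («`(z, g) ↦ (z, z⁻¹g)`»). REAL. [cite: RapoportSmithlingZhang2020Diagonal, §2.1 (2.1) p. 8] -/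
def scalarGL {S : Type} [CommRing S] (κ : Type) [Fintype κ] [DecidableEq κ] (z : Sˣ) : GL κ S :=
  Units.map ((Matrix.scalar κ : S →+* Matrix κ κ S) : S →* Matrix κ κ S) z

/-! ## §2.1 (p. 7): the hermitian space `W`, the special vector `u`, `W♭` (REAL datum, READING R2) -/

/-- **The standing linear-algebraic datum of [RSZ2020] §2.1** (p. 7), all REAL: «let `W` be a non-degenerate `F/F₀`-hermitian space of dimension
`n ≥ 2`. We fix a non-isotropic vector `u ∈ W`, which we call the special vector. We denote by `W♭` the orthogonal complement of `u` in `W`.»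
`W` = ★ `Liu2021.AppendixC.HermSpace F₀ F` (hermitian for ★ `conj F₀ F`, `F`-linear in the first variable — RSZ Notation p. 6 «we take hermitian
forms to be linear in the first variable and conjugate-linear in the second»); `W♭` is carried as a hermitian space `Wflat` of dimension `n − 1`
with an isometric embedding `incl` onto `u^⊥ = {x ∈ W ∣ (x, u) = 0}` (READING R2).  Nothing is asserted by this structure.
[cite: RapoportSmithlingZhang2020Diagonal, §2.1 p. 7] -/
structure Sec2Datum : Type 1 where
  /-- «`W` a non-degenerate `F/F₀`-hermitian space» (p. 7): ★ `HermSpace F₀ F`; `n = W.n`. -/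
  W : HermSpace F₀ F
  /-- «of dimension `n ≥ 2`» (p. 7). -/
  two_le_n : 2 ≤ W.n
  /-- «a non-isotropic vector `u ∈ W`, which we call the special vector» (p. 7). -/
  u : W.V
  /-- «non-isotropic» (p. 7): `(u, u) ≠ 0`. -/
  form_u_ne_zero : W.form u u ≠ 0
  /-- «`W♭` the orthogonal complement of `u` in `W`» (p. 7), as a hermitian space in its own right (READING R2). -/
  Wflat : HermSpace F₀ F
  /-- `dim W♭ = n − 1` (p. 7: `H = U(W♭)` is the `GL_{n−1}`-size group; READING R2). -/
  n_flat : Wflat.n + 1 = W.n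
  /-- The inclusion `W♭ ⊂ W`, `F`-linear (READING R2). -/
  incl : Wflat.V →ₗ[F] W.V
  /-- `incl` is isometric: `(incl x, incl y)_W = (x, y)_{W♭}` (READING R2). -/
  incl_form : ∀ x y : Wflat.V, W.form (incl x) (incl y) = Wflat.form x y
  /-- The image of `incl` is exactly «the orthogonal complement of `u` in `W`» (p. 7; READING R2). -/
  range_incl : ∀ x : W.V, (∃ y : Wflat.V, incl y = x) ↔ W.form x u = 0

namespace Sec2Datum

variable {F₀ F}
variable (D : Sec2Datum F₀ F)

/-- The adapted index type `Fin (n−1) ⊕ Unit` of the basis `(incl e₁, …, incl e_{n−1}, u)` of `W = W♭ ⊕ F u` (p. 8; READING R3).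
[cite: RapoportSmithlingZhang2020Diagonal, §2.1 p. 8 («the decomposition `W = W♭ ⊕ Fu`»)] -/
abbrev Idx : Type := Fin D.Wflat.n ⊕ Unit

/-- **The Gram matrix `J_W` of `W` in the adapted basis** `(incl e₁, …, incl e_{n−1}, u)` (READING R3): `diag(J_{W♭}, (u,u))`, `J_{W♭}` = ★
`HermSpace.gram` of `W♭` (convention ★ `gram i j = (e_j, e_i)`).  Off-diagonal blocks vanish because `incl(W♭) = u^⊥` (`range_incl`).
[cite: RapoportSmithlingZhang2020Diagonal, §2.1 pp. 7–8] -/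
def gramW : Matrix D.Idx D.Idx F :=
  Matrix.fromBlocks D.Wflat.gram 0 0 (Matrix.of fun _ _ => D.W.form D.u D.u)

/-! ## §2.1 (p. 7): the unitary groups `G`, `H`, `G_W`, `H_W` over `F₀` (functor of points on commutative `F₀`-algebras, READINGS R1, R3) -/

/-- **`G := U(W)`** (p. 7), on `A`-points: `G(A) = U(W)(A) = {g ∈ GL(W ⊗_{F₀} A) ∣ ḡᵀ J_W g = J_W} ≤ GL_{Fin(n−1) ⊕ Unit}(F ⊗_{F₀} A)` in the adapted
coordinates (★ `UnitaryScheme.points` at `(c, J_W)`; READINGS R1, R3). [cite: RapoportSmithlingZhang2020Diagonal, §2.1 p. 7] -/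
abbrev Gpts (A : Type) [CommRing A] [Algebra F₀ A] : Subgroup (GL D.Idx (F ⊗[F₀] A)) :=
  UnitaryScheme.points F₀ F (cbar F₀ F) D.Idx D.gramW A

/-- **`H := U(W♭)`** (p. 7), on `A`-points: `H(A) = U(W♭)(A) ≤ GL_{n−1}(F ⊗_{F₀} A)` — literally ★ `HermSpace.unitaryGroup` of `W♭` (coordinates
of ★ `W♭.basis`). [cite: RapoportSmithlingZhang2020Diagonal, §2.1 p. 7] -/
abbrev Hpts (A : Type) [CommRing A] [Algebra F₀ A] : Subgroup (GL (Fin D.Wflat.n) (F ⊗[F₀] A)) :=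
  D.Wflat.unitaryGroup A

/-- **`G_W := H × G`** (p. 7), on `A`-points: the product subgroup `H(A) × G(A)`. [cite: RapoportSmithlingZhang2020Diagonal, §2.1 p. 7] -/
abbrev GWpts (A : Type) [CommRing A] [Algebra F₀ A] :
    Subgroup (GL (Fin D.Wflat.n) (F ⊗[F₀] A) × GL D.Idx (F ⊗[F₀] A)) :=
  (D.Hpts A).prod (D.Gpts A)

/-- **`H_W := H × H`** (p. 7), on `A`-points. [cite: RapoportSmithlingZhang2020Diagonal, §2.1 p. 7] -/
abbrev HWpts (A : Type) [CommRing A] [Algebra F₀ A] :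
    Subgroup (GL (Fin D.Wflat.n) (F ⊗[F₀] A) × GL (Fin D.Wflat.n) (F ⊗[F₀] A)) :=
  (D.Hpts A).prod (D.Hpts A)

/-- The embedding `H ↪ G`, `h ↦ diag(h, 1)`, induced by `W = W♭ ⊕ F u` (p. 8: the embeddings (2.2) «are obtained by applying the functor `Z^ℚ × −`
to the embeddings `Res_{F₀/ℚ} H ↪ Res_{F₀/ℚ} G` …»), on `A`-points of the ambient `GL`'s (READING R3).
[cite: RapoportSmithlingZhang2020Diagonal, §2.1 (2.2) p. 8] -/
def inclHG {S : Type} [CommRing S] (h : GL (Fin D.Wflat.n) S) : GL D.Idx S :=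
  blockDiagGL h 1

end Sec2Datum

/-! ## §2.1 (pp. 7–8): the groups over `ℚ` — ambient rings `F₀ ⊗_ℚ R`, `F ⊗_ℚ R`, the involution, `Nm_{F/F₀}`, `Z^ℚ`, the similitude identity (READINGS R1, R4) -/

/-- `F₀ ⊗_ℚ R` for a commutative `ℚ`-algebra `R` (the `F₀`-algebra through which `Res_{F₀/ℚ}` is evaluated, READING R1; as in ★ `HermSpace.resPoints`).
[cite: RapoportSmithlingZhang2020Diagonal, §2.1 p. 7] -/
abbrev AR (R : Type) [CommRing R] [Algebra ℚ R] : Type := F₀ ⊗[ℚ] R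

/-- `F ⊗_ℚ R`, realised as `F ⊗_{F₀} (F₀ ⊗_ℚ R)` (READING R4). [cite: RapoportSmithlingZhang2020Diagonal, §2.1 p. 7] -/
abbrev ER (R : Type) [CommRing R] [Algebra ℚ R] : Type := F ⊗[F₀] (F₀ ⊗[ℚ] R)

/-- The involution `a ⊗ r ↦ ā ⊗ r` of `F ⊗_ℚ R` (★ `UnitaryScheme.baseConj`), `z ↦ z̄`. [cite: RapoportSmithlingZhang2020Diagonal, §1 Notation p. 5] -/
abbrev cR (R : Type) [CommRing R] [Algebra ℚ R] : ER F₀ F R →ₐ[F₀] ER F₀ F R :=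
  UnitaryScheme.baseConj F₀ F (cbar F₀ F) (AR F₀ R)

/-- The structure map `R → F ⊗_ℚ R`, `r ↦ 1 ⊗ r`, through which `𝔾_m(R) = Rˣ` is compared with `Res_{F₀/ℚ}𝔾_m(R) ⊂ Res_{F/ℚ}𝔾_m(R)` («`c(g) ∈ 𝔾_m`»,
«`Nm_{F/F₀}(z) ∈ 𝔾_m`», p. 7; READING R4). [cite: RapoportSmithlingZhang2020Diagonal, §2.1 p. 7] -/
def ofR (R : Type) [CommRing R] [Algebra ℚ R] : R →+* ER F₀ F R :=
  (Algebra.TensorProduct.includeRight : AR F₀ R →ₐ[F₀] ER F₀ F R).toRingHom.comp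
    (Algebra.TensorProduct.includeRight : R →ₐ[ℚ] AR F₀ R).toRingHom

/-- `Nm_{F/F₀}(z) = z z̄` on `F ⊗_ℚ R` (the norm of `Res_{F/ℚ}𝔾_m → Res_{F₀/ℚ}𝔾_m` on `R`-points, p. 7). REAL.
[cite: RapoportSmithlingZhang2020Diagonal, §2.1 p. 7] -/
def nm (R : Type) [CommRing R] [Algebra ℚ R] (z : ER F₀ F R) : ER F₀ F R :=
  z * cR F₀ F R z

/-- **`Z^ℚ := {z ∈ Res_{F/ℚ} 𝔾_m ∣ Nm_{F/F₀}(z) ∈ 𝔾_m}`** (p. 7), on `R`-points, as pairs `(z, t) ∈ (F ⊗_ℚ R)ˣ × Rˣ` with `Nm_{F/F₀}(z) = t`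
(READING R4: the graph of `Nm` on the printed group). [cite: RapoportSmithlingZhang2020Diagonal, §2.1 p. 7] -/
def ZQ (R : Type) [CommRing R] [Algebra ℚ R] : Set ((ER F₀ F R)ˣ × Rˣ) :=
  {p | nm F₀ F R (p.1 : ER F₀ F R) = ofR F₀ F R (p.2 : R)}

/-- The similitude identity «`(gx, gy) = c·(x, y)`» in coordinates: `ḡᵀ (J ⊗ 1) g = c·(J ⊗ 1)` for `g ∈ GL_κ(F ⊗_ℚ R)`, `c ∈ Rˣ` and a Gram
matrix `J ∈ M_κ(F)` (★ `UnitaryScheme.baseForm` = `J ⊗ 1`; READINGS R3, R4) — the condition defining `GU(W)`-points «with `c(g) ∈ 𝔾_m`» (p. 7).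
[cite: RapoportSmithlingZhang2020Diagonal, §2.1 p. 7] -/
def IsSimil (R : Type) [CommRing R] [Algebra ℚ R] {κ : Type} [Fintype κ] [DecidableEq κ] (J : Matrix κ κ F)
    (g : GL κ (ER F₀ F R)) (c : Rˣ) : Prop :=
  ((g : Matrix κ κ (ER F₀ F R)).map (cR F₀ F R)).transpose * UnitaryScheme.baseForm F₀ F κ J (AR F₀ R) *
      (g : Matrix κ κ (ER F₀ F R)) =
    ofR F₀ F R (c : R) • UnitaryScheme.baseForm F₀ F κ J (AR F₀ R)


/-! ## §2.1 (pp. 7–8): `H^ℚ`, `G^ℚ`, `H̃`, `G̃`, `H̃G` for the datum (functor of points on commutative `ℚ`-algebras, READINGS R1, R3, R4) -/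

namespace Sec2Datum

variable {F₀ F}
variable (D : Sec2Datum F₀ F)

/-- **`G^ℚ := {g ∈ Res_{F₀/ℚ} GU(W) ∣ c(g) ∈ 𝔾_m}`** (p. 7), on `R`-points, as pairs `(g, c(g))` (READING R4) in the adapted coordinates (READING R3).
[cite: RapoportSmithlingZhang2020Diagonal, §2.1 p. 7] -/
def GQ (R : Type) [CommRing R] [Algebra ℚ R] : Set (GL D.Idx (ER F₀ F R) × Rˣ) :=
  {p | IsSimil F₀ F R D.gramW p.1 p.2}

/-- **`H^ℚ := {h ∈ Res_{F₀/ℚ} GU(W♭) ∣ c(h) ∈ 𝔾_m}`** (p. 7), on `R`-points, as pairs `(h, c(h))` (READING R4), coordinates of ★ `W♭.basis`.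
[cite: RapoportSmithlingZhang2020Diagonal, §2.1 p. 7] -/
def HQ (R : Type) [CommRing R] [Algebra ℚ R] : Set (GL (Fin D.Wflat.n) (ER F₀ F R) × Rˣ) :=
  {p | IsSimil F₀ F R D.Wflat.gram p.1 p.2}

/-- **`G̃ := Z^ℚ ×_{𝔾_m} G^ℚ = {(z, g) ∈ Z^ℚ × G^ℚ ∣ Nm_{F/F₀}(z) = c(g)}`** (p. 7), on `R`-points, as triples `(z, g, c)` with
`Nm_{F/F₀}(z) = c = c(g)` (READING R4). [cite: RapoportSmithlingZhang2020Diagonal, §2.1 p. 7] -/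
def Gtilde (R : Type) [CommRing R] [Algebra ℚ R] : Set ((ER F₀ F R)ˣ × GL D.Idx (ER F₀ F R) × Rˣ) :=
  {p | (p.1, p.2.2) ∈ ZQ F₀ F R ∧ (p.2.1, p.2.2) ∈ D.GQ R}

/-- **`H̃ := Z^ℚ ×_{𝔾_m} H^ℚ = {(z, h) ∈ Z^ℚ × H^ℚ ∣ Nm_{F/F₀}(z) = c(h)}`** (p. 7), on `R`-points, as triples `(z, h, c)` (READING R4).
[cite: RapoportSmithlingZhang2020Diagonal, §2.1 p. 7] -/
def Htilde (R : Type) [CommRing R] [Algebra ℚ R] : Set ((ER F₀ F R)ˣ × GL (Fin D.Wflat.n) (ER F₀ F R) × Rˣ) :=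
  {p | (p.1, p.2.2) ∈ ZQ F₀ F R ∧ (p.2.1, p.2.2) ∈ D.HQ R}

/-- **`H̃G := H̃ ×_{Z^ℚ} G̃ = Z^ℚ ×_{𝔾_m} H^ℚ ×_{𝔾_m} G^ℚ = {(z, h, g) ∈ Z^ℚ × H^ℚ × G^ℚ ∣ Nm_{F/F₀}(z) = c(h) = c(g)}`** (p. 7), on `R`-points, as
quadruples `(z, h, g, c)` with the common multiplier `c` (READING R4). [cite: RapoportSmithlingZhang2020Diagonal, §2.1 p. 7] -/
def HGtilde (R : Type) [CommRing R] [Algebra ℚ R] :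
    Set ((ER F₀ F R)ˣ × GL (Fin D.Wflat.n) (ER F₀ F R) × GL D.Idx (ER F₀ F R) × Rˣ) :=
  {p | (p.1, p.2.2.2) ∈ ZQ F₀ F R ∧ (p.2.1, p.2.2.2) ∈ D.HQ R ∧ (p.2.2.1, p.2.2.2) ∈ D.GQ R}

/-! ## p. 8: «`Z^ℚ` is naturally a central subgroup of `H^ℚ` and `G^ℚ`», and the product decompositions (2.1) -/

/-- The natural map `Z^ℚ → G^ℚ`, `z ↦ (z·1_W, Nm_{F/F₀}(z))` on `R`-points (p. 8: «`Z^ℚ` is naturally a central subgroup of `H^ℚ` and `G^ℚ`»).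
REAL. [cite: RapoportSmithlingZhang2020Diagonal, §2.1 p. 8] -/
def zToGQ (R : Type) [CommRing R] [Algebra ℚ R] (p : (ER F₀ F R)ˣ × Rˣ) : GL D.Idx (ER F₀ F R) × Rˣ :=
  (scalarGL D.Idx p.1, p.2)

/-- The natural map `Z^ℚ → H^ℚ`, `z ↦ (z·1_{W♭}, Nm_{F/F₀}(z))` on `R`-points (p. 8). REAL. [cite: RapoportSmithlingZhang2020Diagonal, §2.1 p. 8] -/
def zToHQ (R : Type) [CommRing R] [Algebra ℚ R] (p : (ER F₀ F R)ˣ × Rˣ) : GL (Fin D.Wflat.n) (ER F₀ F R) × Rˣ :=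
  (scalarGL (Fin D.Wflat.n) p.1, p.2)

/-- «`Z^ℚ` is naturally a central subgroup of `H^ℚ` and `G^ℚ`» (p. 8, unnumbered), on `R`-points: `z ↦ z·1` carries `Z^ℚ(R)` into `G^ℚ(R)` and
into `H^ℚ(R)`, injectively, with central image.  Named fact (predicate on the datum). [cite: RapoportSmithlingZhang2020Diagonal, §2.1 p. 8] -/
def ZQ_central : Prop :=
  ∀ (R : Type) [CommRing R] [Algebra ℚ R],
    Set.InjOn (D.zToGQ R) (ZQ F₀ F R) ∧ Set.MapsTo (D.zToGQ R) (ZQ F₀ F R) (D.GQ R) ∧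
      (∀ z ∈ ZQ F₀ F R, ∀ g ∈ D.GQ R, D.zToGQ R z * g = g * D.zToGQ R z) ∧
    Set.InjOn (D.zToHQ R) (ZQ F₀ F R) ∧ Set.MapsTo (D.zToHQ R) (ZQ F₀ F R) (D.HQ R) ∧
      (∀ z ∈ ZQ F₀ F R, ∀ h ∈ D.HQ R, D.zToHQ R z * h = h * D.zToHQ R z)

/-- **(2.1), for `G̃`**: the map «`G̃ → Z^ℚ × Res_{F₀/ℚ} G`, `(z, g) ↦ (z, z⁻¹g)`» on `R`-points (`Res_{F₀/ℚ} G (R) = G(F₀ ⊗_ℚ R)`, READING R1).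
REAL. [cite: RapoportSmithlingZhang2020Diagonal, §2.1 (2.1) p. 8] -/
def dec21G (R : Type) [CommRing R] [Algebra ℚ R] (p : (ER F₀ F R)ˣ × GL D.Idx (ER F₀ F R) × Rˣ) :
    ((ER F₀ F R)ˣ × Rˣ) × GL D.Idx (ER F₀ F R) :=
  ((p.1, p.2.2), (scalarGL D.Idx p.1)⁻¹ * p.2.1)

/-- **(2.1), for `H̃`**: «`H̃ → Z^ℚ × Res_{F₀/ℚ} H`, `(z, h) ↦ (z, z⁻¹h)`» on `R`-points. REAL. [cite: RapoportSmithlingZhang2020Diagonal, §2.1 (2.1) p. 8] -/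
def dec21H (R : Type) [CommRing R] [Algebra ℚ R] (p : (ER F₀ F R)ˣ × GL (Fin D.Wflat.n) (ER F₀ F R) × Rˣ) :
    ((ER F₀ F R)ˣ × Rˣ) × GL (Fin D.Wflat.n) (ER F₀ F R) :=
  ((p.1, p.2.2), (scalarGL (Fin D.Wflat.n) p.1)⁻¹ * p.2.1)

/-- **(2.1), for `H̃G`**: «`H̃G → Z^ℚ × Res_{F₀/ℚ}(H × G)`, `(z, h, g) ↦ (z, z⁻¹h, z⁻¹g)`» on `R`-points. REAL.
[cite: RapoportSmithlingZhang2020Diagonal, §2.1 (2.1) p. 8] -/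
def dec21HG (R : Type) [CommRing R] [Algebra ℚ R]
    (p : (ER F₀ F R)ˣ × GL (Fin D.Wflat.n) (ER F₀ F R) × GL D.Idx (ER F₀ F R) × Rˣ) :
    ((ER F₀ F R)ˣ × Rˣ) × (GL (Fin D.Wflat.n) (ER F₀ F R) × GL D.Idx (ER F₀ F R)) :=
  ((p.1, p.2.2.2), ((scalarGL (Fin D.Wflat.n) p.1)⁻¹ * p.2.1, (scalarGL D.Idx p.1)⁻¹ * p.2.2.1))

/-- **(2.1)** (p. 8): «these inclusions give rise to product decompositions `H̃ ⥲ Z^ℚ × Res_{F₀/ℚ} H`, `(z, h) ↦ (z, z⁻¹h)`;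
`G̃ ⥲ Z^ℚ × Res_{F₀/ℚ} G`, `(z, g) ↦ (z, z⁻¹g)`; `H̃G ⥲ Z^ℚ × Res_{F₀/ℚ}(H × G)`, `(z, h, g) ↦ (z, z⁻¹h, z⁻¹g)`» — on `R`-points for every
commutative `ℚ`-algebra `R` (READING R1): each printed map is a bijection from the `R`-points of the source onto `Z^ℚ(R) × 𝒢(F₀ ⊗_ℚ R)`.
Named fact (predicate on the datum). [cite: RapoportSmithlingZhang2020Diagonal, §2.1 (2.1) p. 8] -/
def Eq21_productDecomposition : Prop :=
  ∀ (R : Type) [CommRing R] [Algebra ℚ R],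
    Set.BijOn (D.dec21H R) (D.Htilde R) ((ZQ F₀ F R) ×ˢ (D.Hpts (AR F₀ R) : Set (GL (Fin D.Wflat.n) (ER F₀ F R)))) ∧
    Set.BijOn (D.dec21G R) (D.Gtilde R) ((ZQ F₀ F R) ×ˢ (D.Gpts (AR F₀ R) : Set (GL D.Idx (ER F₀ F R)))) ∧
    Set.BijOn (D.dec21HG R) (D.HGtilde R)
      ((ZQ F₀ F R) ×ˢ ((D.Hpts (AR F₀ R) : Set (GL (Fin D.Wflat.n) (ER F₀ F R))) ×ˢ (D.Gpts (AR F₀ R) : Set (GL D.Idx (ER F₀ F R)))))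

/-! ## (2.2) (p. 8): the closed embeddings `H̃ ↪ G̃` and `H̃ ↪ H̃G` -/

/-- **(2.2), first embedding**: «`H̃ ↪ G̃`, `(z, h) ↦ (z, diag(h, z))`» on `R`-points (block matrix in the adapted basis, READING R3; the
multiplier is carried along, READING R4). REAL. [cite: RapoportSmithlingZhang2020Diagonal, §2.1 (2.2) p. 8] -/
def emb22G (R : Type) [CommRing R] [Algebra ℚ R] (p : (ER F₀ F R)ˣ × GL (Fin D.Wflat.n) (ER F₀ F R) × Rˣ) :
    (ER F₀ F R)ˣ × GL D.Idx (ER F₀ F R) × Rˣ :=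
  (p.1, blockDiagGL p.2.1 p.1, p.2.2)

/-- **(2.2), second embedding**: «`H̃ ↪ H̃G`, `(z, h) ↦ (z, h, diag(h, z))`» on `R`-points. REAL. [cite: RapoportSmithlingZhang2020Diagonal, §2.1 (2.2) p. 8] -/
def emb22HG (R : Type) [CommRing R] [Algebra ℚ R] (p : (ER F₀ F R)ˣ × GL (Fin D.Wflat.n) (ER F₀ F R) × Rˣ) :
    (ER F₀ F R)ˣ × GL (Fin D.Wflat.n) (ER F₀ F R) × GL D.Idx (ER F₀ F R) × Rˣ :=
  (p.1, p.2.1, blockDiagGL p.2.1 p.1, p.2.2)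

/-- **(2.2)** (p. 8): «the decomposition `W = W♭ ⊕ Fu` gives rise to natural closed embeddings of algebraic groups `H̃ ↪ G̃`, `(z, h) ↦ (z, diag(h, z))`,
and `H̃ ↪ H̃G`, `(z, h) ↦ (z, h, diag(h, z))`» — on `R`-points: both maps carry `H̃(R)` into `G̃(R)` resp. `H̃G(R)` and are injective there
(«closed» is an attribute of the morphisms of group schemes and is not typed, READING R1).  Named fact (predicate on the datum).
[cite: RapoportSmithlingZhang2020Diagonal, §2.1 (2.2) p. 8] -/
def Eq22_embeddings : Prop :=
  ∀ (R : Type) [CommRing R] [Algebra ℚ R],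
    Set.MapsTo (D.emb22G R) (D.Htilde R) (D.Gtilde R) ∧ Set.InjOn (D.emb22G R) (D.Htilde R) ∧
    Set.MapsTo (D.emb22HG R) (D.Htilde R) (D.HGtilde R) ∧ Set.InjOn (D.emb22HG R) (D.Htilde R)

/-- (p. 8, the sentence after (2.2)): «Thus, in terms of the product decompositions in (2.1), the embeddings `H̃ ↪ G̃` and `H̃ ↪ H̃G` in (2.2) are
obtained by applying the functor `Z^ℚ × −` to the embeddings `Res_{F₀/ℚ} H ↪ Res_{F₀/ℚ} G` and `Res_{F₀/ℚ} H ↪ Res_{F₀/ℚ}(H × G)`, respectively»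
— on `R`-points: `dec21G ∘ emb22G = (id × (h ↦ diag(h,1))) ∘ dec21H` and `dec21HG ∘ emb22HG = (id × (h ↦ (h, diag(h,1)))) ∘ dec21H` on `H̃(R)`
(`H ↪ G` = `inclHG`, READING R3).  Named fact (predicate on the datum). [cite: RapoportSmithlingZhang2020Diagonal, §2.1 p. 8 (after (2.2))] -/
def Eq22_compatible : Prop :=
  ∀ (R : Type) [CommRing R] [Algebra ℚ R], ∀ p ∈ D.Htilde R,
    D.dec21G R (D.emb22G R p) = ((D.dec21H R p).1, D.inclHG (D.dec21H R p).2) ∧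
    D.dec21HG R (D.emb22HG R p) = ((D.dec21H R p).1, ((D.dec21H R p).2, D.inclHG (D.dec21H R p).2))

/-! ## §2.2 «Orbit matching» (p. 8): Lemma 2.1 (READING R5) -/

/-- **[RSZ2020, Lemma 2.1, first isomorphism]** (p. 8): «The natural projections in (2.1) induce isomorphisms `G̃/H̃ ⥲ Res_{F₀/ℚ} G / Res_{F₀/ℚ} H`»
— ON `R`-POINTS (READING R5), `H̃ ⊂ G̃` via (2.2) and `H ⊂ G` via `h ↦ diag(h, 1)`: for every commutative `ℚ`-algebra `R`, the projection
`(z, g) ↦ z⁻¹g` (the second component of `dec21G`) maps `G̃(R)` ONTO `G(F₀ ⊗_ℚ R)`, and two points of `G̃(R)` have images in the same right `H(F₀ ⊗_ℚ R)`-coset iff they lie in the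
same right `H̃(R)`-coset — i.e. it induces a bijection `G̃(R)/H̃(R) ⥲ G(F₀ ⊗_ℚ R)/H(F₀ ⊗_ℚ R)`.  («The following lemma is obvious.»)  Named fact
(predicate on the datum). [cite: RapoportSmithlingZhang2020Diagonal, §2.2 Lemma 2.1 p. 8] -/
def Lemma21_coset : Prop :=
  ∀ (R : Type) [CommRing R] [Algebra ℚ R],
    Set.SurjOn (fun p => (D.dec21G R p).2) (D.Gtilde R) (D.Gpts (AR F₀ R) : Set (GL D.Idx (ER F₀ F R))) ∧
    ∀ x ∈ D.Gtilde R, ∀ y ∈ D.Gtilde R,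
      (∃ h ∈ D.Htilde R, y = x * D.emb22G R h) ↔
        ∃ h' ∈ D.Hpts (AR F₀ R), (D.dec21G R y).2 = (D.dec21G R x).2 * D.inclHG h'

/-- **[RSZ2020, Lemma 2.1, second isomorphism]** (p. 8): «… and `H̃\H̃G/H̃ ⥲ Res_{F₀/ℚ} H \ Res_{F₀/ℚ} G_W / Res_{F₀/ℚ} H`» — ON `R`-POINTS
(READING R5), `H̃` acting on `H̃G` on both sides through (2.2) `(z, h) ↦ (z, h, diag(h, z))`, and `H` on `G_W = H × G` on both sides through
`h ↦ (h, diag(h, 1))`: the projection `(z, h, g) ↦ (z⁻¹h, z⁻¹g)` (the second component of `dec21HG`) maps `H̃G(R)` ONTO `G_W(F₀ ⊗_ℚ R) = H(F₀ ⊗_ℚ R) × G(F₀ ⊗_ℚ R)` and identifies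
`H̃(R)`-double cosets with `H(F₀ ⊗_ℚ R)`-double cosets.  Named fact (predicate on the datum). [cite: RapoportSmithlingZhang2020Diagonal, §2.2 Lemma 2.1 p. 8] -/
def Lemma21_doubleCoset : Prop :=
  ∀ (R : Type) [CommRing R] [Algebra ℚ R],
    Set.SurjOn (fun p => (D.dec21HG R p).2) (D.HGtilde R)
      (D.GWpts (AR F₀ R) : Set (GL (Fin D.Wflat.n) (ER F₀ F R) × GL D.Idx (ER F₀ F R))) ∧
    ∀ x ∈ D.HGtilde R, ∀ y ∈ D.HGtilde R,
      (∃ h₁ ∈ D.Htilde R, ∃ h₂ ∈ D.Htilde R, y = D.emb22HG R h₁ * x * D.emb22HG R h₂) ↔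
        ∃ h₁' ∈ D.Hpts (AR F₀ R), ∃ h₂' ∈ D.Hpts (AR F₀ R),
          (D.dec21HG R y).2 = (h₁', D.inclHG h₁') * (D.dec21HG R x).2 * (h₂', D.inclHG h₂')

/-- **[RSZ2020, Lemma 2.1]** (p. 8), both isomorphisms, on `R`-points (READING R5): the conjunction of `Lemma21_coset` and `Lemma21_doubleCoset`.
The sequel of §2.2 (the orbit-matching injection for regular semisimple elements and (2.3)) is RECORDED in the module docstring, NOT typed.
[cite: RapoportSmithlingZhang2020Diagonal, §2.2 Lemma 2.1 p. 8] -/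
def Lemma21 : Prop :=
  D.Lemma21_coset ∧ D.Lemma21_doubleCoset

end Sec2Datum

/-! ## ED. 2 (squad ruling R-9a): tree-provable closed rows PROVED — «`Z^ℚ` is central in `H^ℚ` and `G^ℚ`» (p. 8) and the sentence after (2.2) -/

section ScalarBlockAPI

variable {S : Type} [CommRing S] {κ : Type} [Fintype κ] [DecidableEq κ]

/-- API: the matrix of `scalarGL κ z` is the scalar matrix `z·1` (Mathlib `Matrix.scalar`).  Our lemma. [cite: RapoportSmithlingZhang2020Diagonal, §2.1 (2.1) p. 8] -/
theorem scalarGL_val (z : Sˣ) : ((scalarGL κ z : GL κ S) : Matrix κ κ S) = Matrix.scalar κ (z : S) := rfl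

/-- API: the matrix of `(scalarGL κ z)⁻¹` is `z⁻¹·1`.  Our lemma. [cite: RapoportSmithlingZhang2020Diagonal, §2.1 (2.1) p. 8] -/
theorem scalarGL_inv_val (z : Sˣ) :
    (((scalarGL κ z)⁻¹ : GL κ S) : Matrix κ κ S) = Matrix.scalar κ ((z⁻¹ : Sˣ) : S) := by
  unfold scalarGL
  rw [← map_inv, Units.coe_map]
  rfl

/-- API: `(z·1)⁻¹ = z⁻¹·1`, `(zw)·1 = (z·1)(w·1)`, `1·1 = 1` — `scalarGL κ` is a group homomorphism (it IS ★ `Units.map` of `Matrix.scalar`).  Our lemmas.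
[cite: RapoportSmithlingZhang2020Diagonal, §2.1 (2.1) p. 8] -/
theorem scalarGL_inv (z : Sˣ) : (scalarGL κ z)⁻¹ = scalarGL κ z⁻¹ := by
  unfold scalarGL; rw [map_inv]

/-- API: `(zw)·1 = (z·1)(w·1)`.  Our lemma. [cite: RapoportSmithlingZhang2020Diagonal, §2.1 (2.1) p. 8] -/
theorem scalarGL_mul (z w : Sˣ) : scalarGL κ (z * w) = scalarGL κ z * scalarGL κ w := by
  unfold scalarGL; rw [map_mul]

/-- API: `1·1 = 1`.  Our lemma. [cite: RapoportSmithlingZhang2020Diagonal, §2.1 (2.1) p. 8] -/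
theorem scalarGL_one : scalarGL κ (1 : Sˣ) = 1 := by
  unfold scalarGL; rw [map_one]

/-- API: the matrix of `blockDiagGL h z` is `diag(h, z)` (Mathlib `Matrix.fromBlocks`).  Our lemma. [cite: RapoportSmithlingZhang2020Diagonal, §2.1 (2.2) p. 8] -/
theorem blockDiagGL_val (h : GL κ S) (z : Sˣ) :
    ((blockDiagGL h z : GL (κ ⊕ Unit) S) : Matrix (κ ⊕ Unit) (κ ⊕ Unit) S) =
      Matrix.fromBlocks (h : Matrix κ κ S) 0 0 (Matrix.scalar Unit (z : S)) := rfl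

/-- API: the matrix of `z·g` (`scalarGL κ z * g`) is `z • g`.  Our lemma. [cite: RapoportSmithlingZhang2020Diagonal, §2.1 (2.1) p. 8] -/
theorem scalarGL_mul_val (z : Sˣ) (g : GL κ S) :
    ((scalarGL κ z * g : GL κ S) : Matrix κ κ S) = (z : S) • (g : Matrix κ κ S) := by
  rw [Units.val_mul, scalarGL_val, Matrix.scalar_apply, ← Matrix.smul_eq_diagonal_mul]

/-- API: the matrix of «`z⁻¹g`» (`(scalarGL κ z)⁻¹ * g`, the second component of the decompositions (2.1)) is `z⁻¹ • g`.  Our lemma.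
[cite: RapoportSmithlingZhang2020Diagonal, §2.1 (2.1) p. 8] -/
theorem scalarGL_inv_mul_val (z : Sˣ) (g : GL κ S) :
    (((scalarGL κ z)⁻¹ * g : GL κ S) : Matrix κ κ S) = ((z⁻¹ : Sˣ) : S) • (g : Matrix κ κ S) := by
  rw [Units.val_mul, scalarGL_inv_val, Matrix.scalar_apply, ← Matrix.smul_eq_diagonal_mul]

/-- `z ↦ z·1 : Sˣ → GL_κ(S)` is injective when `κ` is non-empty (Mathlib `Matrix.scalar_inj`).  Our lemma.
[cite: RapoportSmithlingZhang2020Diagonal, §2.1 p. 8] -/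
theorem scalarGL_injective [Nonempty κ] : Function.Injective (scalarGL κ : Sˣ → GL κ S) := by
  intro z z' h
  have h' := congrArg (fun g : GL κ S => (g : Matrix κ κ S)) h
  simp only [scalarGL_val, Matrix.scalar_inj] at h'
  exact Units.ext h'

/-- Scalar matrices are central in `GL_κ(S)` (Mathlib `Matrix.scalar_commute`).  Our lemma. [cite: RapoportSmithlingZhang2020Diagonal, §2.1 p. 8] -/
theorem scalarGL_comm (z : Sˣ) (g : GL κ S) : scalarGL κ z * g = g * scalarGL κ z :=
  Units.ext ((Matrix.scalar_commute (z : S) (fun r' => Commute.all _ r') (g : Matrix κ κ S)).eq)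

/-- `(z·1)⁻¹` is central in `GL_κ(S)` as well.  Our lemma. [cite: RapoportSmithlingZhang2020Diagonal, §2.1 p. 8] -/
theorem scalarGL_inv_comm (z : Sˣ) (g : GL κ S) : (scalarGL κ z)⁻¹ * g = g * (scalarGL κ z)⁻¹ := by
  rw [scalarGL_inv]; exact scalarGL_comm _ _

/-- `z⁻¹ · diag(h, z) = diag(z⁻¹h, 1)` in `GL_{κ ⊕ Unit}(S)` — the matrix identity behind «the embeddings … in (2.2) are obtained by applying the functor
`Z^ℚ × −` to the embeddings `Res_{F₀/ℚ} H ↪ Res_{F₀/ℚ} G` …» (p. 8).  Our lemma. [cite: RapoportSmithlingZhang2020Diagonal, §2.1 p. 8 (after (2.2))] -/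
theorem scalarGL_inv_mul_blockDiagGL (h : GL κ S) (z : Sˣ) :
    (scalarGL (κ ⊕ Unit) z)⁻¹ * blockDiagGL h z = blockDiagGL ((scalarGL κ z)⁻¹ * h) 1 := by
  apply Units.ext
  change (((scalarGL (κ ⊕ Unit) z)⁻¹ : GL (κ ⊕ Unit) S) : Matrix (κ ⊕ Unit) (κ ⊕ Unit) S) *
      (blockDiagGL h z : Matrix (κ ⊕ Unit) (κ ⊕ Unit) S) =
    (blockDiagGL ((scalarGL κ z)⁻¹ * h) 1 : Matrix (κ ⊕ Unit) (κ ⊕ Unit) S)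
  rw [blockDiagGL_val, blockDiagGL_val, Units.val_mul, scalarGL_inv_val, scalarGL_inv_val]
  ext i j
  rcases i with i | ⟨⟩ <;> rcases j with j | ⟨⟩ <;> simp [Matrix.scalar_apply, Matrix.diagonal_mul]

/-- `z · diag(h, 1) = diag(z h, z)` in `GL_{κ ⊕ Unit}(S)` (the inverse reading of `scalarGL_inv_mul_blockDiagGL`).  Our lemma.
[cite: RapoportSmithlingZhang2020Diagonal, §2.1 p. 8 (after (2.2))] -/
theorem scalarGL_mul_blockDiagGL (h : GL κ S) (z : Sˣ) :
    scalarGL (κ ⊕ Unit) z * blockDiagGL h 1 = blockDiagGL (scalarGL κ z * h) z := by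
  have e := scalarGL_inv_mul_blockDiagGL (scalarGL κ z * h) z
  rw [inv_mul_cancel_left, inv_mul_eq_iff_eq_mul] at e
  exact e.symm

/-- Coset bookkeeping for Lemma 2.1 (first isomorphism, «⇒»): `(zw)⁻¹·(g·diag(k, w)) = (z⁻¹g)·diag(w⁻¹k, 1)` — scalars are central.  Our lemma.
[cite: RapoportSmithlingZhang2020Diagonal, §2.2 Lemma 2.1 p. 8] -/
theorem scalarGL_coset_identity (z w : Sˣ) (g : GL (κ ⊕ Unit) S) (k : GL κ S) :
    (scalarGL (κ ⊕ Unit) (z * w))⁻¹ * (g * blockDiagGL k w) =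
      (scalarGL (κ ⊕ Unit) z)⁻¹ * g * blockDiagGL ((scalarGL κ w)⁻¹ * k) 1 := by
  rw [← scalarGL_inv_mul_blockDiagGL, scalarGL_mul, mul_inv_rev]
  have hc : ∀ X : GL (κ ⊕ Unit) S, X * (scalarGL (κ ⊕ Unit) w)⁻¹ = (scalarGL (κ ⊕ Unit) w)⁻¹ * X :=
    fun X => (scalarGL_inv_comm w X).symm
  calc (scalarGL (κ ⊕ Unit) w)⁻¹ * (scalarGL (κ ⊕ Unit) z)⁻¹ * (g * blockDiagGL k w)
      = ((scalarGL (κ ⊕ Unit) z)⁻¹ * (scalarGL (κ ⊕ Unit) w)⁻¹) * (g * blockDiagGL k w) := by rw [hc]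
    _ = (scalarGL (κ ⊕ Unit) z)⁻¹ * (((scalarGL (κ ⊕ Unit) w)⁻¹ * g) * blockDiagGL k w) := by simp only [mul_assoc]
    _ = (scalarGL (κ ⊕ Unit) z)⁻¹ * ((g * (scalarGL (κ ⊕ Unit) w)⁻¹) * blockDiagGL k w) := by rw [hc g]
    _ = (scalarGL (κ ⊕ Unit) z)⁻¹ * g * ((scalarGL (κ ⊕ Unit) w)⁻¹ * blockDiagGL k w) := by simp only [mul_assoc]

/-- Double-coset bookkeeping for Lemma 2.1 (second isomorphism, «⇒»): `(w₁ z w₂)⁻¹·(a b c) = (w₁⁻¹a)(z⁻¹b)(w₂⁻¹c)` — scalars are central.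
Our lemma. [cite: RapoportSmithlingZhang2020Diagonal, §2.2 Lemma 2.1 p. 8] -/
theorem scalarGL_triple_identity (w₁ z w₂ : Sˣ) (a b c : GL κ S) :
    (scalarGL κ (w₁ * z * w₂))⁻¹ * (a * b * c) =
      ((scalarGL κ w₁)⁻¹ * a) * ((scalarGL κ z)⁻¹ * b) * ((scalarGL κ w₂)⁻¹ * c) := by
  rw [scalarGL_mul, scalarGL_mul, mul_inv_rev, mul_inv_rev]
  have hc₁ : ∀ X : GL κ S, X * (scalarGL κ w₁)⁻¹ = (scalarGL κ w₁)⁻¹ * X := fun X => (scalarGL_inv_comm w₁ X).symm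
  have hc₂ : ∀ X : GL κ S, X * (scalarGL κ z)⁻¹ = (scalarGL κ z)⁻¹ * X := fun X => (scalarGL_inv_comm z X).symm
  have hc₃ : ∀ X : GL κ S, X * (scalarGL κ w₂)⁻¹ = (scalarGL κ w₂)⁻¹ * X := fun X => (scalarGL_inv_comm w₂ X).symm
  calc (scalarGL κ w₂)⁻¹ * ((scalarGL κ z)⁻¹ * (scalarGL κ w₁)⁻¹) * (a * b * c)
      = (scalarGL κ w₂)⁻¹ * ((scalarGL κ w₁)⁻¹ * (scalarGL κ z)⁻¹) * (a * b * c) := by rw [hc₁ ((scalarGL κ z)⁻¹)]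
    _ = ((scalarGL κ w₁)⁻¹ * (scalarGL κ z)⁻¹) * (scalarGL κ w₂)⁻¹ * (a * b * c) := by
          rw [← hc₃ ((scalarGL κ w₁)⁻¹ * (scalarGL κ z)⁻¹)]
    _ = (scalarGL κ w₁)⁻¹ * (scalarGL κ z)⁻¹ * ((scalarGL κ w₂)⁻¹ * a) * (b * c) := by simp only [mul_assoc]
    _ = (scalarGL κ w₁)⁻¹ * (scalarGL κ z)⁻¹ * (a * (scalarGL κ w₂)⁻¹) * (b * c) := by rw [← hc₃ a]
    _ = (scalarGL κ w₁)⁻¹ * ((scalarGL κ z)⁻¹ * a) * ((scalarGL κ w₂)⁻¹ * b) * c := by simp only [mul_assoc]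
    _ = (scalarGL κ w₁)⁻¹ * (a * (scalarGL κ z)⁻¹) * (b * (scalarGL κ w₂)⁻¹) * c := by rw [← hc₂ a, ← hc₃ b]
    _ = ((scalarGL κ w₁)⁻¹ * a) * ((scalarGL κ z)⁻¹ * b) * ((scalarGL κ w₂)⁻¹ * c) := by simp only [mul_assoc]

/-- Double-coset bookkeeping for Lemma 2.1 (second isomorphism, «⇐»): `z₂·(A (z⁻¹B) C) = A B (z⁻¹ z₂ C)` — scalars are central.  Our lemma.
[cite: RapoportSmithlingZhang2020Diagonal, §2.2 Lemma 2.1 p. 8] -/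
theorem scalarGL_triple_identity' (z z₂ : Sˣ) (A B C : GL κ S) :
    scalarGL κ z₂ * (A * ((scalarGL κ z)⁻¹ * B) * C) = A * B * ((scalarGL κ z)⁻¹ * scalarGL κ z₂ * C) := by
  have hv : ∀ X : GL κ S, X * scalarGL κ z₂ = scalarGL κ z₂ * X := fun X => (scalarGL_comm z₂ X).symm
  have hu : ∀ X : GL κ S, X * (scalarGL κ z)⁻¹ = (scalarGL κ z)⁻¹ * X := fun X => (scalarGL_inv_comm z X).symm
  calc scalarGL κ z₂ * (A * ((scalarGL κ z)⁻¹ * B) * C)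
      = (scalarGL κ z₂ * A) * ((scalarGL κ z)⁻¹ * B) * C := by simp only [mul_assoc]
    _ = (A * scalarGL κ z₂) * ((scalarGL κ z)⁻¹ * B) * C := by rw [← hv A]
    _ = A * (scalarGL κ z₂ * (scalarGL κ z)⁻¹) * B * C := by simp only [mul_assoc]
    _ = A * ((scalarGL κ z)⁻¹ * scalarGL κ z₂) * B * C := by rw [hu (scalarGL κ z₂)]
    _ = A * (scalarGL κ z)⁻¹ * (scalarGL κ z₂ * B) * C := by simp only [mul_assoc]
    _ = A * (scalarGL κ z)⁻¹ * (B * scalarGL κ z₂) * C := by rw [← hv B]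
    _ = A * ((scalarGL κ z)⁻¹ * B) * (scalarGL κ z₂ * C) := by simp only [mul_assoc]
    _ = A * (B * (scalarGL κ z)⁻¹) * (scalarGL κ z₂ * C) := by rw [← hu B]
    _ = A * B * ((scalarGL κ z)⁻¹ * scalarGL κ z₂ * C) := by simp only [mul_assoc]

/-- `diag(h, z) = diag(h', z')` forces `h = h'` (Mathlib `Matrix.fromBlocks_inj`) — injectivity of the embeddings (2.2) in the `h`-slot.  Our lemma.
[cite: RapoportSmithlingZhang2020Diagonal, §2.1 (2.2) p. 8] -/
theorem blockDiagGL_left_inj {h h' : GL κ S} {z z' : Sˣ} (e : blockDiagGL h z = blockDiagGL h' z') : h = h' := by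
  have e' := congrArg (fun g : GL (κ ⊕ Unit) S => (g : Matrix (κ ⊕ Unit) (κ ⊕ Unit) S)) e
  simp only [blockDiagGL_val, Matrix.fromBlocks_inj] at e'
  exact Units.ext e'.1

end ScalarBlockAPI

/-- For `(z, t) ∈ Z^ℚ(R)` (`Nm_{F/F₀}(z) = t`, `ZQ`) the scalar `z·1 ∈ GL_κ(F ⊗_ℚ R)` satisfies the similitude identity `IsSimil` with multiplier `t` for ANY
Gram matrix `J`: `(z̄·1)ᵀ (J ⊗ 1) (z·1) = z z̄ · (J ⊗ 1) = t · (J ⊗ 1)` — the computation behind «`Z^ℚ` is naturally a central subgroup of `H^ℚ` and `G^ℚ`»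
(p. 8).  Our proof (entrywise). [cite: RapoportSmithlingZhang2020Diagonal, §2.1 p. 8] -/
theorem isSimil_scalarGL_of_mem_ZQ (R : Type) [CommRing R] [Algebra ℚ R] {κ : Type} [Fintype κ] [DecidableEq κ] (J : Matrix κ κ F)
    (p : (ER F₀ F R)ˣ × Rˣ) (hp : p ∈ ZQ F₀ F R) : IsSimil F₀ F R J (scalarGL κ p.1) p.2 := by
  obtain ⟨z, t⟩ := p
  change nm F₀ F R (z : ER F₀ F R) = ofR F₀ F R (t : R) at hp
  unfold IsSimil
  rw [scalarGL_val]
  ext i j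
  simp [Matrix.scalar_apply, Matrix.diagonal_map, Matrix.diagonal_transpose, Matrix.mul_diagonal, Matrix.diagonal_mul,
    Matrix.smul_apply]
  rw [← hp]
  unfold nm
  ring

/-- `Z^ℚ(R)` is closed under multiplication (it IS a subgroup of `Res_{F/ℚ}𝔾_m × 𝔾_m`: `Nm_{F/F₀}` is multiplicative).  Our lemma.
[cite: RapoportSmithlingZhang2020Diagonal, §2.1 p. 7] -/
theorem mul_mem_ZQ (R : Type) [CommRing R] [Algebra ℚ R] {p q : (ER F₀ F R)ˣ × Rˣ} (hp : p ∈ ZQ F₀ F R) (hq : q ∈ ZQ F₀ F R) :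
    p * q ∈ ZQ F₀ F R := by
  obtain ⟨z, c⟩ := p
  obtain ⟨z', c'⟩ := q
  change (z : ER F₀ F R) * cR F₀ F R (z : ER F₀ F R) = ofR F₀ F R (c : R) at hp
  change (z' : ER F₀ F R) * cR F₀ F R (z' : ER F₀ F R) = ofR F₀ F R (c' : R) at hq
  change ((z * z' : (ER F₀ F R)ˣ) : ER F₀ F R) * cR F₀ F R ((z * z' : (ER F₀ F R)ˣ) : ER F₀ F R) = ofR F₀ F R ((c * c' : Rˣ) : R)
  rw [Units.val_mul, Units.val_mul, map_mul, map_mul, ← hp, ← hq]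
  ring

/-- `Z^ℚ(R)` is closed under inverses.  Our lemma. [cite: RapoportSmithlingZhang2020Diagonal, §2.1 p. 7] -/
theorem inv_mem_ZQ (R : Type) [CommRing R] [Algebra ℚ R] {p : (ER F₀ F R)ˣ × Rˣ} (hp : p ∈ ZQ F₀ F R) : p⁻¹ ∈ ZQ F₀ F R := by
  obtain ⟨z, c⟩ := p
  change (z : ER F₀ F R) * cR F₀ F R (z : ER F₀ F R) = ofR F₀ F R (c : R) at hp
  change ((z⁻¹ : (ER F₀ F R)ˣ) : ER F₀ F R) * cR F₀ F R ((z⁻¹ : (ER F₀ F R)ˣ) : ER F₀ F R) = ofR F₀ F R ((c⁻¹ : Rˣ) : R)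
  calc ((z⁻¹ : (ER F₀ F R)ˣ) : ER F₀ F R) * cR F₀ F R ((z⁻¹ : (ER F₀ F R)ˣ) : ER F₀ F R)
      = (ofR F₀ F R ((c⁻¹ : Rˣ) : R) * ofR F₀ F R (c : R)) *
          (((z⁻¹ : (ER F₀ F R)ˣ) : ER F₀ F R) * cR F₀ F R ((z⁻¹ : (ER F₀ F R)ˣ) : ER F₀ F R)) := by
        rw [← map_mul, Units.inv_mul, map_one, one_mul]
    _ = ofR F₀ F R ((c⁻¹ : Rˣ) : R) *
          (((z : ER F₀ F R) * ((z⁻¹ : (ER F₀ F R)ˣ) : ER F₀ F R)) * (cR F₀ F R (z : ER F₀ F R) * cR F₀ F R ((z⁻¹ : (ER F₀ F R)ˣ) : ER F₀ F R))) := by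
        rw [← hp]; ring
    _ = ofR F₀ F R ((c⁻¹ : Rˣ) : R) := by rw [← map_mul, Units.mul_inv, map_one, mul_one, mul_one]

/-- `1 ∈ Z^ℚ(R)`.  Our lemma. [cite: RapoportSmithlingZhang2020Diagonal, §2.1 p. 7] -/
theorem one_mem_ZQ (R : Type) [CommRing R] [Algebra ℚ R] : (1 : (ER F₀ F R)ˣ × Rˣ) ∈ ZQ F₀ F R := by
  change ((1 : (ER F₀ F R)ˣ) : ER F₀ F R) * cR F₀ F R ((1 : (ER F₀ F R)ˣ) : ER F₀ F R) = ofR F₀ F R ((1 : Rˣ) : R)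
  simp

omit [NumberField F₀] [IsTotallyReal F₀] [NumberField F] [IsTotallyComplex F] [Algebra.IsQuadraticExtension F₀ F] in
/-- `(diag(J, a)) ⊗ 1 = diag(J ⊗ 1, a ⊗ 1)`: ★ `UnitaryScheme.baseForm` of a block-diagonal Gram matrix (the shape of `gramW = diag(J_{W♭}, (u,u))`) is
block-diagonal (Mathlib `Matrix.fromBlocks_map`).  Our lemma. [cite: RapoportSmithlingZhang2020Diagonal, §2.1 pp. 7–8] -/
theorem baseForm_fromBlocks (A : Type) [CommRing A] [Algebra F₀ A] {κ : Type} [Fintype κ] [DecidableEq κ] (J : Matrix κ κ F) (a : F) :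
    UnitaryScheme.baseForm F₀ F (κ ⊕ Unit) (Matrix.fromBlocks J 0 0 (Matrix.of fun _ _ => a)) A =
      Matrix.fromBlocks (UnitaryScheme.baseForm F₀ F κ J A) 0 0 (UnitaryScheme.baseForm F₀ F Unit (Matrix.of fun (_ _ : Unit) => a) A) := by
  unfold UnitaryScheme.baseForm
  rw [Matrix.fromBlocks_map, Matrix.map_zero _ (by simp), Matrix.map_zero _ (by simp)]

/-- **`diag(h, z)` is a similitude of `diag(J, a)` with multiplier `c`** whenever `h` is a similitude of `J` with multiplier `c` and `(z, c) ∈ Z^ℚ(R)`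
(`Nm_{F/F₀}(z) = c`): block by block, `(h̄ᵀ (J ⊗ 1) h, z̄ (a ⊗ 1) z) = (c·(J ⊗ 1), c·(a ⊗ 1))` — the computation behind «natural closed embeddings … `H̃ ↪ G̃`,
`(z, h) ↦ (z, diag(h, z))`» (2.2) (p. 8).  Our proof. [cite: RapoportSmithlingZhang2020Diagonal, §2.1 (2.2) p. 8] -/
theorem isSimil_blockDiagGL (R : Type) [CommRing R] [Algebra ℚ R] {κ : Type} [Fintype κ] [DecidableEq κ] (J : Matrix κ κ F) (a : F)
    (h : GL κ (ER F₀ F R)) (z : (ER F₀ F R)ˣ) (c : Rˣ)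
    (hh : IsSimil F₀ F R J h c) (hz : ((z, c) : (ER F₀ F R)ˣ × Rˣ) ∈ ZQ F₀ F R) :
    IsSimil F₀ F R (Matrix.fromBlocks J 0 0 (Matrix.of fun _ _ => a)) (blockDiagGL h z) c := by
  have hs := isSimil_scalarGL_of_mem_ZQ F₀ F R (Matrix.of fun (_ _ : Unit) => a) (z, c) hz
  unfold IsSimil at hh hs ⊢
  rw [scalarGL_val] at hs
  rw [blockDiagGL_val, baseForm_fromBlocks, Matrix.fromBlocks_map, Matrix.fromBlocks_transpose, Matrix.fromBlocks_multiply,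
    Matrix.fromBlocks_multiply, Matrix.fromBlocks_smul, Matrix.fromBlocks_inj]
  simp only [Matrix.map_zero _ (map_zero _), Matrix.transpose_zero, Matrix.zero_mul, Matrix.mul_zero, add_zero, zero_add,
    smul_zero]
  exact ⟨hh, trivial, trivial, hs⟩

/-- `((a•g)̄)ᵀ B (a•g) = (ā a) • (ḡᵀ B g)`: scaling a matrix by `a ∈ F ⊗_ℚ R` scales the form `ḡᵀ B g` by `ā a = Nm_{F/F₀}(a)` — the one-line
computation behind (2.1) («`(z, g) ↦ (z, z⁻¹g)`»).  Our proof (entrywise). [cite: RapoportSmithlingZhang2020Diagonal, §2.1 (2.1) p. 8] -/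
theorem conjForm_smul (R : Type) [CommRing R] [Algebra ℚ R] {κ : Type} [Fintype κ] (a : ER F₀ F R) (M B : Matrix κ κ (ER F₀ F R)) :
    ((a • M).map (cR F₀ F R)).transpose * B * (a • M) = (cR F₀ F R a * a) • ((M.map (cR F₀ F R)).transpose * B * M) := by
  ext i j
  simp only [Matrix.mul_apply, Matrix.transpose_apply, Matrix.map_apply, Matrix.smul_apply, smul_eq_mul, map_mul,
    Finset.sum_mul, Finset.mul_sum]
  refine Finset.sum_congr rfl fun l _ => Finset.sum_congr rfl fun k _ => ?_
  ring

/-- **`z⁻¹g ∈ U(J)(F₀ ⊗_ℚ R)`** for `g` a similitude of `J` with multiplier `c` and `(z, c) ∈ Z^ℚ(R)`: `(z̄⁻¹ z⁻¹)·c·(J ⊗ 1) = (z z̄)⁻¹ (z z̄)·(J ⊗ 1) = J ⊗ 1`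
— the map of (2.1) lands in `Res_{F₀/ℚ} 𝒢` (★ `UnitaryScheme.points` at `F₀ ⊗_ℚ R`).  Our proof. [cite: RapoportSmithlingZhang2020Diagonal, §2.1 (2.1) p. 8] -/
theorem mem_points_of_isSimil (R : Type) [CommRing R] [Algebra ℚ R] {κ : Type} [Fintype κ] [DecidableEq κ] (J : Matrix κ κ F)
    (g : GL κ (ER F₀ F R)) (z : (ER F₀ F R)ˣ) (c : Rˣ)
    (hg : IsSimil F₀ F R J g c) (hz : ((z, c) : (ER F₀ F R)ˣ × Rˣ) ∈ ZQ F₀ F R) :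
    (scalarGL κ z)⁻¹ * g ∈ UnitaryScheme.points F₀ F (cbar F₀ F) κ J (AR F₀ R) := by
  change (z : ER F₀ F R) * cR F₀ F R (z : ER F₀ F R) = ofR F₀ F R (c : R) at hz
  unfold IsSimil at hg
  rw [Literature.NumberTheory.Automorphic.UnitaryScheme.mem_points_iff, scalarGL_inv_mul_val, conjForm_smul]
  erw [hg]
  rw [smul_smul, ← hz]
  have h1 : cR F₀ F R ((z⁻¹ : (ER F₀ F R)ˣ) : ER F₀ F R) * ((z⁻¹ : (ER F₀ F R)ˣ) : ER F₀ F R) *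
      ((z : ER F₀ F R) * cR F₀ F R (z : ER F₀ F R)) = 1 := by
    calc cR F₀ F R ((z⁻¹ : (ER F₀ F R)ˣ) : ER F₀ F R) * ((z⁻¹ : (ER F₀ F R)ˣ) : ER F₀ F R) *
          ((z : ER F₀ F R) * cR F₀ F R (z : ER F₀ F R))
        = (cR F₀ F R ((z⁻¹ : (ER F₀ F R)ˣ) : ER F₀ F R) * cR F₀ F R (z : ER F₀ F R)) *
            (((z⁻¹ : (ER F₀ F R)ˣ) : ER F₀ F R) * (z : ER F₀ F R)) := by ring
      _ = 1 := by rw [← map_mul, Units.inv_mul, map_one, one_mul]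
  rw [h1, one_smul]

/-- **`z g₀` is a similitude of `J` with multiplier `t`** for `g₀ ∈ U(J)(F₀ ⊗_ℚ R)` and `(z, t) ∈ Z^ℚ(R)`: `(z̄ z)·(J ⊗ 1) = t·(J ⊗ 1)` — the inverse
of (2.1), `(z, g₀) ↦ (z, z g₀)`.  Our proof. [cite: RapoportSmithlingZhang2020Diagonal, §2.1 (2.1) p. 8] -/
theorem isSimil_of_mem_points (R : Type) [CommRing R] [Algebra ℚ R] {κ : Type} [Fintype κ] [DecidableEq κ] (J : Matrix κ κ F)
    (g₀ : GL κ (ER F₀ F R)) (z : (ER F₀ F R)ˣ) (t : Rˣ)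
    (hg₀ : g₀ ∈ UnitaryScheme.points F₀ F (cbar F₀ F) κ J (AR F₀ R)) (hz : ((z, t) : (ER F₀ F R)ˣ × Rˣ) ∈ ZQ F₀ F R) :
    IsSimil F₀ F R J (scalarGL κ z * g₀) t := by
  change (z : ER F₀ F R) * cR F₀ F R (z : ER F₀ F R) = ofR F₀ F R (t : R) at hz
  rw [Literature.NumberTheory.Automorphic.UnitaryScheme.mem_points_iff] at hg₀
  unfold IsSimil
  rw [scalarGL_mul_val, conjForm_smul]
  erw [hg₀]
  rw [← hz, mul_comm]

namespace Sec2Datum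

variable {F₀ F}
variable (D : Sec2Datum F₀ F)

/-- **«`Z^ℚ` is naturally a central subgroup of `H^ℚ` and `G^ℚ`» holds** (discharge of `ZQ_central`, squad ruling R-9a): `z ↦ (z·1, Nm z)` is injective on
`Z^ℚ(R)` (the index types `Fin (n−1) ⊕ Unit` and `Fin (n−1)` are non-empty as `n ≥ 2`), lands in `G^ℚ(R)` resp. `H^ℚ(R)` (`isSimil_scalarGL_of_mem_ZQ`), and its
image is central (scalar matrices commute with every matrix; `Rˣ` is commutative).  Our proof. [cite: RapoportSmithlingZhang2020Diagonal, §2.1 p. 8] -/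
theorem ZQ_central_holds : D.ZQ_central := by
  intro R _ _
  haveI : Nonempty (Fin D.Wflat.n) := ⟨⟨0, by have := D.two_le_n; have := D.n_flat; omega⟩⟩
  refine ⟨?_, ?_, ?_, ?_, ?_, ?_⟩
  · intro p _ q _ h
    unfold Sec2Datum.zToGQ at h
    obtain ⟨h1, h2⟩ := Prod.mk.inj h
    exact Prod.ext (scalarGL_injective h1) h2
  · intro p hp
    exact isSimil_scalarGL_of_mem_ZQ F₀ F R D.gramW p hp
  · intro z _ g _
    exact Prod.ext (scalarGL_comm _ _) (mul_comm _ _)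
  · intro p _ q _ h
    unfold Sec2Datum.zToHQ at h
    obtain ⟨h1, h2⟩ := Prod.mk.inj h
    exact Prod.ext (scalarGL_injective h1) h2
  · intro p hp
    exact isSimil_scalarGL_of_mem_ZQ F₀ F R D.Wflat.gram p hp
  · intro z _ g _
    exact Prod.ext (scalarGL_comm _ _) (mul_comm _ _)

/-- **(2.1) holds on `R`-points** (discharge of `Eq21_productDecomposition`, squad ruling R-9a): each of «`H̃ ⥲ Z^ℚ × Res_{F₀/ℚ} H`, `(z, h) ↦ (z, z⁻¹h)`;
`G̃ ⥲ Z^ℚ × Res_{F₀/ℚ} G`; `H̃G ⥲ Z^ℚ × Res_{F₀/ℚ}(H × G)`» is a bijection onto `Z^ℚ(R) × 𝒢(F₀ ⊗_ℚ R)`: it lands there (`mem_points_of_isSimil`: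
`z⁻¹g` is `J`-unitary), it is injective (cancel `z⁻¹`), and `(z, g₀) ↦ (z, z g₀)` is a section (`isSimil_of_mem_points`).  Our proof.
[cite: RapoportSmithlingZhang2020Diagonal, §2.1 (2.1) p. 8] -/
theorem Eq21_productDecomposition_holds : D.Eq21_productDecomposition := by
  intro R _ _
  refine ⟨⟨?_, ?_, ?_⟩, ⟨?_, ?_, ?_⟩, ⟨?_, ?_, ?_⟩⟩
  · rintro ⟨z, h, c⟩ ⟨hz, hh⟩
    exact ⟨hz, mem_points_of_isSimil F₀ F R D.Wflat.gram h z c hh hz⟩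
  · rintro ⟨z, h, c⟩ _ ⟨z', h', c'⟩ _ e
    simp only [Sec2Datum.dec21H, Prod.mk.injEq] at e
    obtain ⟨⟨rfl, rfl⟩, e2⟩ := e
    rw [mul_left_cancel e2]
  · rintro ⟨⟨z, t⟩, h₀⟩ ⟨hz, hh₀⟩
    refine ⟨(z, scalarGL (Fin D.Wflat.n) z * h₀, t), ⟨hz, isSimil_of_mem_points F₀ F R D.Wflat.gram h₀ z t hh₀ hz⟩, ?_⟩
    simp only [Sec2Datum.dec21H, inv_mul_cancel_left]
  · rintro ⟨z, g, c⟩ ⟨hz, hg⟩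
    exact ⟨hz, mem_points_of_isSimil F₀ F R D.gramW g z c hg hz⟩
  · rintro ⟨z, g, c⟩ _ ⟨z', g', c'⟩ _ e
    simp only [Sec2Datum.dec21G, Prod.mk.injEq] at e
    obtain ⟨⟨rfl, rfl⟩, e2⟩ := e
    rw [mul_left_cancel e2]
  · rintro ⟨⟨z, t⟩, g₀⟩ ⟨hz, hg₀⟩
    refine ⟨(z, scalarGL D.Idx z * g₀, t), ⟨hz, isSimil_of_mem_points F₀ F R D.gramW g₀ z t hg₀ hz⟩, ?_⟩
    simp only [Sec2Datum.dec21G, inv_mul_cancel_left]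
  · rintro ⟨z, h, g, c⟩ ⟨hz, hh, hg⟩
    exact ⟨hz, mem_points_of_isSimil F₀ F R D.Wflat.gram h z c hh hz, mem_points_of_isSimil F₀ F R D.gramW g z c hg hz⟩
  · rintro ⟨z, h, g, c⟩ _ ⟨z', h', g', c'⟩ _ e
    simp only [Sec2Datum.dec21HG, Prod.mk.injEq] at e
    obtain ⟨⟨rfl, rfl⟩, e2, e3⟩ := e
    rw [mul_left_cancel e2, mul_left_cancel e3]
  · rintro ⟨⟨z, t⟩, h₀, g₀⟩ ⟨hz, hh₀, hg₀⟩
    refine ⟨(z, scalarGL (Fin D.Wflat.n) z * h₀, scalarGL D.Idx z * g₀, t),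
      ⟨hz, isSimil_of_mem_points F₀ F R D.Wflat.gram h₀ z t hh₀ hz, isSimil_of_mem_points F₀ F R D.gramW g₀ z t hg₀ hz⟩, ?_⟩
    simp only [Sec2Datum.dec21HG, inv_mul_cancel_left]

/-- **The sentence after (2.2) holds** (discharge of `Eq22_compatible`, squad ruling R-9a): on `R`-points `dec21G ∘ emb22G = (id × (h ↦ diag(h,1))) ∘ dec21H`
and `dec21HG ∘ emb22HG = (id × (h ↦ (h, diag(h,1)))) ∘ dec21H`, because `z⁻¹·diag(h, z) = diag(z⁻¹h, 1)` (`scalarGL_inv_mul_blockDiagGL`); the other components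
agree definitionally.  Our proof. [cite: RapoportSmithlingZhang2020Diagonal, §2.1 p. 8 (after (2.2))] -/
theorem Eq22_compatible_holds : D.Eq22_compatible := by
  intro R _ _ p _
  exact ⟨Prod.ext rfl (scalarGL_inv_mul_blockDiagGL p.2.1 p.1),
    Prod.ext rfl (Prod.ext rfl (scalarGL_inv_mul_blockDiagGL p.2.1 p.1))⟩

/-- **(2.2) holds on `R`-points** (discharge of `Eq22_embeddings`, squad ruling R-9a): `(z, h) ↦ (z, diag(h, z))` carries `H̃(R)` into `G̃(R)` and
`(z, h) ↦ (z, h, diag(h, z))` carries `H̃(R)` into `H̃G(R)` — the `Z^ℚ`-condition is carried along and `diag(h, z)` is a similitude of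
`J_W = diag(J_{W♭}, (u,u))` with the same multiplier (`isSimil_blockDiagGL`) — and both maps are injective (`diag(h, z)` determines `h`,
`blockDiagGL_left_inj`; the other slots are read off directly).  Our proof. [cite: RapoportSmithlingZhang2020Diagonal, §2.1 (2.2) p. 8] -/
theorem Eq22_embeddings_holds : D.Eq22_embeddings := by
  intro R _ _
  refine ⟨?_, ?_, ?_, ?_⟩
  · rintro ⟨z, h, c⟩ ⟨hz, hh⟩
    exact ⟨hz, isSimil_blockDiagGL F₀ F R D.Wflat.gram (D.W.form D.u D.u) h z c hh hz⟩
  · rintro ⟨z, h, c⟩ _ ⟨z', h', c'⟩ _ e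
    simp only [Sec2Datum.emb22G, Prod.mk.injEq] at e
    obtain ⟨rfl, e2, rfl⟩ := e
    rw [blockDiagGL_left_inj e2]
  · rintro ⟨z, h, c⟩ ⟨hz, hh⟩
    exact ⟨hz, hh, isSimil_blockDiagGL F₀ F R D.Wflat.gram (D.W.form D.u D.u) h z c hh hz⟩
  · rintro ⟨z, h, c⟩ _ ⟨z', h', c'⟩ _ e
    simp only [Sec2Datum.emb22HG, Prod.mk.injEq] at e
    obtain ⟨rfl, rfl, -, rfl⟩ := e
    rfl

/-- **[RSZ2020, Lemma 2.1, first isomorphism] holds on `R`-points** (discharge of `Lemma21_coset`, squad ruling R-9a): `(z, g) ↦ z⁻¹g` maps `G̃(R)` ONTO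
`G(F₀ ⊗_ℚ R)` (`g₀ ↦ (1, g₀, 1)` is a section) and matches right `H̃(R)`-cosets with right `H(F₀ ⊗_ℚ R)`-cosets: «⇒» `h' := w⁻¹k` and
`(zw)⁻¹(g·diag(k, w)) = (z⁻¹g)·diag(w⁻¹k, 1)`; «⇐» `h := (z⁻¹z', (z⁻¹z')·h', c⁻¹c') ∈ H̃(R)` (`Z^ℚ` is a group: `mul_mem_ZQ`, `inv_mem_ZQ`) and
`z'·(z⁻¹ g diag(h',1)) = g·((z⁻¹z')·diag(h', 1))` by centrality of scalars.  («The following lemma is obvious», p. 8.)  Our proof.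
[cite: RapoportSmithlingZhang2020Diagonal, §2.2 Lemma 2.1 p. 8] -/
theorem Lemma21_coset_holds : D.Lemma21_coset := by
  intro R _ _
  refine ⟨?_, ?_⟩
  · rintro g₀ hg₀
    refine ⟨(1, g₀, 1), ⟨one_mem_ZQ F₀ F R, ?_⟩, ?_⟩
    · have h := isSimil_of_mem_points F₀ F R D.gramW g₀ 1 1 hg₀ (one_mem_ZQ F₀ F R)
      rw [scalarGL_one, one_mul] at h
      exact h
    · show (scalarGL D.Idx 1)⁻¹ * g₀ = g₀
      rw [scalarGL_one, inv_one, one_mul]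
  · rintro ⟨z, g, c⟩ ⟨hz, hg⟩ ⟨z', g', c'⟩ ⟨hz', hg'⟩
    constructor
    · rintro ⟨⟨w, k, d⟩, ⟨hw, hk⟩, e⟩
      simp only [Prod.mk_mul_mk, Sec2Datum.emb22G, Prod.mk.injEq] at e
      obtain ⟨rfl, rfl, rfl⟩ := e
      refine ⟨(scalarGL (Fin D.Wflat.n) w)⁻¹ * k, mem_points_of_isSimil F₀ F R D.Wflat.gram k w d hk hw, ?_⟩
      exact scalarGL_coset_identity z w g k
    · rintro ⟨h', hh', e⟩
      change (scalarGL D.Idx z')⁻¹ * g' = (scalarGL D.Idx z)⁻¹ * g * blockDiagGL h' 1 at e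
      have hw : ((z⁻¹ * z', c⁻¹ * c') : (ER F₀ F R)ˣ × Rˣ) ∈ ZQ F₀ F R := by
        have := mul_mem_ZQ F₀ F R (inv_mem_ZQ F₀ F R hz) hz'
        simpa using this
      refine ⟨(z⁻¹ * z', scalarGL (Fin D.Wflat.n) (z⁻¹ * z') * h', c⁻¹ * c'),
        ⟨hw, isSimil_of_mem_points F₀ F R D.Wflat.gram h' (z⁻¹ * z') (c⁻¹ * c') hh' hw⟩, ?_⟩
      simp only [Prod.mk_mul_mk, Sec2Datum.emb22G, mul_inv_cancel_left, Prod.mk.injEq, true_and, and_true]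
      rw [← scalarGL_mul_blockDiagGL, scalarGL_mul, ← scalarGL_inv]
      rw [inv_mul_eq_iff_eq_mul] at e
      rw [e]
      have hc : ∀ X : GL D.Idx (ER F₀ F R), X * (scalarGL D.Idx z)⁻¹ = (scalarGL D.Idx z)⁻¹ * X :=
        fun X => (scalarGL_inv_comm z X).symm
      have hc' : ∀ X : GL D.Idx (ER F₀ F R), X * scalarGL D.Idx z' = scalarGL D.Idx z' * X :=
        fun X => (scalarGL_comm z' X).symm
      calc scalarGL D.Idx z' * ((scalarGL D.Idx z)⁻¹ * g * blockDiagGL h' 1)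
          = (scalarGL D.Idx z' * (scalarGL D.Idx z)⁻¹) * (g * blockDiagGL h' 1) := by simp only [mul_assoc]
        _ = ((scalarGL D.Idx z)⁻¹ * scalarGL D.Idx z') * (g * blockDiagGL h' 1) := by rw [hc (scalarGL D.Idx z')]
        _ = (scalarGL D.Idx z)⁻¹ * ((scalarGL D.Idx z' * g) * blockDiagGL h' 1) := by simp only [mul_assoc]
        _ = (scalarGL D.Idx z)⁻¹ * ((g * scalarGL D.Idx z') * blockDiagGL h' 1) := by rw [← hc' g]
        _ = ((scalarGL D.Idx z)⁻¹ * g) * (scalarGL D.Idx z' * blockDiagGL h' 1) := by simp only [mul_assoc]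
        _ = (g * (scalarGL D.Idx z)⁻¹) * (scalarGL D.Idx z' * blockDiagGL h' 1) := by rw [← hc g]
        _ = g * ((scalarGL D.Idx z)⁻¹ * scalarGL D.Idx z' * blockDiagGL h' 1) := by simp only [mul_assoc]

/-- **[RSZ2020, Lemma 2.1, second isomorphism] holds on `R`-points** (discharge of `Lemma21_doubleCoset`, squad ruling R-9a): `(z, h, g) ↦ (z⁻¹h, z⁻¹g)`
maps `H̃G(R)` ONTO `H(F₀ ⊗_ℚ R) × G(F₀ ⊗_ℚ R)` (`(h₀, g₀) ↦ (1, h₀, g₀, 1)` is a section) and matches `H̃(R)`-double cosets with `H(F₀ ⊗_ℚ R)`-double cosets: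
«⇒» `hᵢ' := wᵢ⁻¹kᵢ` and `(w₁ z w₂)⁻¹(a b c) = (w₁⁻¹a)(z⁻¹b)(w₂⁻¹c)` in both slots (`diag(wᵢ⁻¹kᵢ, 1) = wᵢ⁻¹·diag(kᵢ, wᵢ)`); «⇐» `h₁ := (1, h₁', 1)`,
`h₂ := (z⁻¹z₂, (z⁻¹z₂)·h₂', c⁻¹c₂)` and `z₂·(A (z⁻¹B) C) = A B ((z⁻¹z₂) C)` by centrality of scalars.  Our proof.
[cite: RapoportSmithlingZhang2020Diagonal, §2.2 Lemma 2.1 p. 8] -/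
theorem Lemma21_doubleCoset_holds : D.Lemma21_doubleCoset := by
  intro R _ _
  refine ⟨?_, ?_⟩
  · rintro ⟨h₀, g₀⟩ ⟨hh₀, hg₀⟩
    refine ⟨(1, h₀, g₀, 1), ⟨one_mem_ZQ F₀ F R, ?_, ?_⟩, ?_⟩
    · have e := isSimil_of_mem_points F₀ F R D.Wflat.gram h₀ 1 1 hh₀ (one_mem_ZQ F₀ F R)
      rw [scalarGL_one, one_mul] at e
      exact e
    · have e := isSimil_of_mem_points F₀ F R D.gramW g₀ 1 1 hg₀ (one_mem_ZQ F₀ F R)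
      rw [scalarGL_one, one_mul] at e
      exact e
    · show ((scalarGL (Fin D.Wflat.n) 1)⁻¹ * h₀, (scalarGL D.Idx 1)⁻¹ * g₀) = (h₀, g₀)
      rw [scalarGL_one, scalarGL_one, inv_one, inv_one, one_mul, one_mul]
  · rintro ⟨z, h, g, c⟩ ⟨hz, hh, hg⟩ ⟨z₂, h₂, g₂, c₂⟩ ⟨hz₂, hh₂, hg₂⟩
    constructor
    · rintro ⟨⟨w₁, k₁, d₁⟩, ⟨hw₁, hk₁⟩, ⟨w₂, k₂, d₂⟩, ⟨hw₂, hk₂⟩, e⟩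
      simp only [Prod.mk_mul_mk, Sec2Datum.emb22HG, Prod.mk.injEq] at e
      obtain ⟨rfl, rfl, rfl, rfl⟩ := e
      refine ⟨(scalarGL (Fin D.Wflat.n) w₁)⁻¹ * k₁, mem_points_of_isSimil F₀ F R D.Wflat.gram k₁ w₁ d₁ hk₁ hw₁,
        (scalarGL (Fin D.Wflat.n) w₂)⁻¹ * k₂, mem_points_of_isSimil F₀ F R D.Wflat.gram k₂ w₂ d₂ hk₂ hw₂, ?_⟩
      simp only [Sec2Datum.dec21HG, Sec2Datum.inclHG, Prod.mk_mul_mk, Prod.mk.injEq]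
      refine ⟨scalarGL_triple_identity w₁ z w₂ k₁ h k₂, ?_⟩
      rw [← scalarGL_inv_mul_blockDiagGL, ← scalarGL_inv_mul_blockDiagGL]
      exact scalarGL_triple_identity w₁ z w₂ _ g _
    · rintro ⟨a₁, ha₁, a₂, ha₂, e⟩
      simp only [Sec2Datum.dec21HG, Prod.mk_mul_mk, Prod.mk.injEq] at e
      obtain ⟨e1, e2⟩ := e
      rw [inv_mul_eq_iff_eq_mul] at e1 e2
      have hw : ((z⁻¹ * z₂, c⁻¹ * c₂) : (ER F₀ F R)ˣ × Rˣ) ∈ ZQ F₀ F R := by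
        have := mul_mem_ZQ F₀ F R (inv_mem_ZQ F₀ F R hz) hz₂
        simpa using this
      have ha₁' : IsSimil F₀ F R D.Wflat.gram a₁ 1 := by
        have e := isSimil_of_mem_points F₀ F R D.Wflat.gram a₁ 1 1 ha₁ (one_mem_ZQ F₀ F R)
        rw [scalarGL_one, one_mul] at e
        exact e
      refine ⟨(1, a₁, 1), ⟨one_mem_ZQ F₀ F R, ha₁'⟩,
        (z⁻¹ * z₂, scalarGL (Fin D.Wflat.n) (z⁻¹ * z₂) * a₂, c⁻¹ * c₂),
        ⟨hw, isSimil_of_mem_points F₀ F R D.Wflat.gram a₂ (z⁻¹ * z₂) (c⁻¹ * c₂) ha₂ hw⟩, ?_⟩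
      simp only [Prod.mk_mul_mk, Sec2Datum.emb22HG, one_mul, mul_inv_cancel_left, Prod.mk.injEq, true_and, and_true]
      refine ⟨?_, ?_⟩
      · rw [e1, scalarGL_mul, ← scalarGL_inv]
        exact scalarGL_triple_identity' z z₂ a₁ h a₂
      · rw [← scalarGL_mul_blockDiagGL, e2, scalarGL_mul, ← scalarGL_inv]
        exact scalarGL_triple_identity' z z₂ _ g _

/-- **[RSZ2020, Lemma 2.1] holds on `R`-points** (discharge of `Lemma21`): both isomorphisms.  Our proof.
[cite: RapoportSmithlingZhang2020Diagonal, §2.2 Lemma 2.1 p. 8] -/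
theorem Lemma21_holds : D.Lemma21 :=
  ⟨D.Lemma21_coset_holds, D.Lemma21_doubleCoset_holds⟩

end Sec2Datum

end Literature.AlgebraicGeometry.ShimuraVarieties.RapoportSmithlingZhang2020.Sec2GroupTheoreticSetup
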